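import Summits.HodgeConjecture.HodgeConjecture.Theorems.F0P3StubS4FoldCoh   -- ★ the `h2` edition (E1_coh, antiholomorphic half); this file is its TWO-COMPACT-PLACE twin
import Summits.HodgeConjecture.HodgeConjecture.Theorems.F0P3ThreadLetters3Defs        -- ★ (S5-R20 (a)) the TWO-COMPACT-PLACE letter texts BY NAME: `StubE1coh₃`, `CohFinComponentUniqueHol₃∕Antihol₃`, `HodgeTypeRigid₃` (+ monotones, conjugation)
import Summits.HodgeConjecture.HodgeConjecture.Theorems.R90ThreeLeFinrankRealSubfieldOfSixLe   -- ★ p862329 `R90.three_le_finrank_maximalRealSubfield_of_six_le` (`h3` from `h6`; director s2043 (iii))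
import HarnessLib

/-!
# FLOOR-0 P3 «U3-mult» — the S4 FOLD (antiholomorphic half), E1_coh edition, TWO-COMPACT-PLACE TWIN (R90-TF THREAD-₃ link (7b)): `stubS4_of_letters_coh₃` ∕ `stubS4_holds_coh₃`

Cell hodgecm-mathlib, crux item H413 = stmt-HodgeConjecture-24833; R90-TF slab S5 seat R90-C133-p01 (g2), deal (H21); S5 dealer R90-C133-plan (g3) RULING S5-R20 «ONE TEXT HOME, TWO LANES»; heir LEAD F0P3a-plan (g22) RULING (R-44) (C)(7) «S5 LOAN»; director (g40) s2043 (c)(ii)(iii); RULING S5-R19 «₃ twins live Summits-side»; census `R90/R90-C133-p01/g2/CENSUS-L7.md`.  PROOF lane (theorems only; no `def`, no instance, no notation, no `sorry`); ADDITIVE (new module; the ★ original is untouched and imported for its opens and lemmas); `--supports stmt-HodgeConjecture-24833 --as helper`.  HONEST LABEL: this file pays nothing; HC_CM is proved only modulo the 7 printed citations (2 remaining named inputs: hLiu418 = stmt-HodgeConjecture-24832, h413 = stmt-HodgeConjecture-24833) until rung 0 closes.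

WHAT CHANGES w.r.t. ★ `F0P3StubS4FoldCoh` (everything else VERBATIM): `(hE1c : StubE1coh₃)` and `(hE1' : CohFinComponentUniqueAntihol₃)` BY NAME from ★ `F0P3ThreadLetters3Defs`;
`h3 : 3 ≤ [K⁺:ℚ]` beside `h2` by ★ `R90.three_le_finrank_maximalRealSubfield_of_six_le (K F) h6`, passed at the ONE application of each letter (★ :212, ★ :214); the ★-PROVED letters
(D)antihol ∕ (E)antihol keep their `h2` texts; CONCLUSION = ★'s VERBATIM.
PRINT-FAITHFULNESS (director s2043 (iii)): «`3 ≤ [F⁺:ℚ]` is implied by Hyp413 (`6 ≤ [F:ℚ]`); the weakening costs nothing at the summit; anchor [Rogawski1990 §13.3 (13.3.6(c)), two compact places]» — the `3 ≤` clause is a ROUTE restriction of the R90-TF road (Arthur-simple trace formula: two compact real places), not Rogawski's hypothesis.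
References: as in ★ `F0P3StubS4FoldCoh`.
-/

set_option autoImplicit false

-- the mandated namespace has the single-problem summit's repeated segment (`HodgeConjecture.HodgeConjecture`)
set_option linter.dupNamespace false

noncomputable section

namespace Summit.HodgeConjecture.HodgeConjecture.Cruxes.H413.F0P3StubS4FoldCoh3

open scoped InnerProductSpace ENNReal Matrix ComplexOrder
open MeasureTheory NumberField
open Literature.NumberTheory.Automorphic Literature.NumberTheory.Automorphic.UnitaryGroup
open Literature.NumberTheory.Automorphic.UnitaryGroup.CotangentForms (toQuotFun cmArchSection cmCompactFactor)
open Summit.HodgeConjecture.HodgeConjecture.Cruxes.H413.SpectrumJunction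
open Summit.HodgeConjecture.HodgeConjecture.Cruxes.H413.F0P3HilbertProjection
open Summit.HodgeConjecture.HodgeConjecture.Cruxes.H413.F0P3StubS3Fold
open Summit.HodgeConjecture.HodgeConjecture.Cruxes.H413.F0P3StubS4Fold
open Summit.HodgeConjecture.HodgeConjecture.Cruxes.H413.F0P3MultiplicityLocal
open HodgeCM.Model HodgeCM.Model.LiuIndex
open Literature.AlgebraicGeometry.Motives (CMType)
open Literature.NumberTheory.Automorphic.Liu2021
open Summit.HodgeConjecture.CorCM.Lines.A3Liu413 (datum413)
open Summit.HodgeConjecture.HodgeConjecture.Cruxes.H413.CohFormsCarriers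
open Summit.HodgeConjecture.HodgeConjecture.Cruxes.H413.F0P3SchurLineAtPin
open Summit.HodgeConjecture.HodgeConjecture.Cruxes.H413.F0P3ThreadLetters3Defs

/-! ## §1 The S4 fold from E1_coh₃ + E1′a₃ (by name) + (D)a + (E)a (texts) -/

set_option synthInstance.maxHeartbeats 400000 in
set_option maxHeartbeats 8000000 in
/-- **THE S4 FOLD FROM THE LETTERS, E1_coh EDITION, TWO-COMPACT-PLACE TWIN** — ★ `F0P3StubS4FoldCoh.stubS4_of_letters_coh` with `hE1c : StubE1coh₃`, `hE1' : CohFinComponentUniqueAntihol₃`,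
`h3` from `h6` beside `h2`, passed at the one application of each letter; proof otherwise VERBATIM.  HC_CM is proved only modulo the printed citations until rung 0 closes.
[cite: Rogawski1990, §14.6 Thm. 14.6.4; §15.3 ¶1; §12.3 p. 174; Prop. 15.2.1 (b)] [cite: BorelJacquet1979, §4.6] [cite: Dixmier1977, §5.4] [cite: BorelWallach2000, VII 2.10, 3.2 and 3.6]
[cite: Liu2021, proof of Prop. 4.13, l. 2131–2146] -/
theorem stubS4_of_letters_coh₃
    (hE1c : StubE1coh₃)
    (hE1' : CohFinComponentUniqueAntihol₃)
    (hDantihol : ∀ (L : Type) [Field L] [NumberField L] [IsCMField L] (ι : L →+* ℂ) (H : Matrix (Fin 3) (Fin 3) L) (T : GL (Fin 3) ℂ)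
      (hT : (T : Matrix (Fin 3) (Fin 3) ℂ)ᴴ * H.map ι * (T : Matrix (Fin 3) (Fin 3) ℂ) = Literature.Geometry.ComplexHyperbolic.BallModel.J),
      (∀ τ' : L →+* ℂ, InfinitePlace.mk τ' ≠ InfinitePlace.mk ι → (H.map τ').PosDef) →
      2 ≤ Module.finrank ℚ ↥(maximalRealSubfield L) →
      ∀ (μ : Measure (adelicGroupData (↥(maximalRealSubfield L)) L (IsCMField.complexConj L) 3 H).automorphicQuotient)
        [(adelicGroupData (↥(maximalRealSubfield L)) L (IsCMField.complexConj L) 3 H).IsAutomorphicMeasure μ]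
        (P : DiscreteAutomorphicRep (adelicGroupData (↥(maximalRealSubfield L)) L (IsCMField.complexConj L) 3 H) μ)
        (Φ : (adelicGroupData (↥(maximalRealSubfield L)) L (IsCMField.complexConj L) 3 H).Adelic → (Fin 2 → ℂ)),
        Φ ∈ (CotangentForms.holCotForms (↥(maximalRealSubfield L)) L (IsCMField.complexConj L) 3 H (cmArchSection L ι H T hT)
          (cmCompactFactor L ι H T hT)).map (CotangentForms.conjFun (↥(maximalRealSubfield L)) L (IsCMField.complexConj L) 3 H) →
        ∀ (h : ∀ j : Fin 2, MemLp (toQuotFun (adelicGroupData (↥(maximalRealSubfield L)) L (IsCMField.complexConj L) 3 H)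
          fun x => Φ x j) 2 μ),
        (∃ (j : Fin 2), ∃ u ∈ P.space,
          ⟪(u : (adelicGroupData (↥(maximalRealSubfield L)) L (IsCMField.complexConj L) 3 H).L2 μ), (h j).toLp⟫_ℂ ≠ 0) →
        P.IsAntiholCotangentAt (cmArchSection L ι H T hT) (cmCompactFactor L ι H T hT))
    (hEantihol : ∀ (L : Type) [Field L] [NumberField L] [IsCMField L] (ι : L →+* ℂ) (H : Matrix (Fin 3) (Fin 3) L) (T : GL (Fin 3) ℂ)
      (hT : (T : Matrix (Fin 3) (Fin 3) ℂ)ᴴ * H.map ι * (T : Matrix (Fin 3) (Fin 3) ℂ) = Literature.Geometry.ComplexHyperbolic.BallModel.J),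
      (∀ τ' : L →+* ℂ, InfinitePlace.mk τ' ≠ InfinitePlace.mk ι → (H.map τ').PosDef) →
      2 ≤ Module.finrank ℚ ↥(maximalRealSubfield L) →
      ∀ (μ : Measure (adelicGroupData (↥(maximalRealSubfield L)) L (IsCMField.complexConj L) 3 H).automorphicQuotient)
      [(adelicGroupData (↥(maximalRealSubfield L)) L (IsCMField.complexConj L) 3 H).IsAutomorphicMeasure μ]
      (W : Type) [AddCommGroup W] [Module ℂ W]
      (σ : Representation ℂ (finAdelic (↥(maximalRealSubfield L)) L (IsCMField.complexConj L) 3 H) W),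
      σ.IsIrreducible → σ.IsSmooth → σ.IsAdmissible →
      ∀ P : DiscreteAutomorphicRep (adelicGroupData (↥(maximalRealSubfield L)) L (IsCMField.complexConj L) 3 H) μ,
      ∃ ψ₀ : W →ₗ[ℂ] ((adelicGroupData (↥(maximalRealSubfield L)) L (IsCMField.complexConj L) 3 H).Adelic → (Fin 2 → ℂ)),
      ∀ ψ : W →ₗ[ℂ] ((adelicGroupData (↥(maximalRealSubfield L)) L (IsCMField.complexConj L) 3 H).Adelic → (Fin 2 → ℂ)),
      (∀ (g : finAdelic (↥(maximalRealSubfield L)) L (IsCMField.complexConj L) 3 H) (w : W),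
      ψ (σ g w) = CotangentForms.rightRep (↥(maximalRealSubfield L)) L (IsCMField.complexConj L) 3 H g (ψ w)) →
      (∀ w : W, ψ w ∈ (CotangentForms.holCotForms (↥(maximalRealSubfield L)) L (IsCMField.complexConj L) 3 H (cmArchSection L ι H T hT)
      (cmCompactFactor L ι H T hT)).map (CotangentForms.conjFun (↥(maximalRealSubfield L)) L (IsCMField.complexConj L) 3 H) ∧
      P.ContainsForm (ψ w)) →
      ∃ r : ℂ, ψ = r • ψ₀)
    (hcont : ∀ (F : HodgeCM.CMField) {ι₁ : F →+* ℂ} (V : HodgeCM.HermSpace3 F ι₁), 4 ≤ Module.finrank ℚ F →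
      ∀ f ∈ cohForms (archFactorOf F V), ∀ j : Fin 2, Continuous fun x => f x j) :
    ∀ (hDel : Literature.AlgebraicGeometry.ShimuraVarieties.UnitaryCanonicalModel.canonicalModel_exists_printed)
      (F : HodgeCM.CMField) [IsGalois ℚ F] (h6 : 6 ≤ Module.finrank ℚ F) {ι₁ : F →+* ℂ} (V : HodgeCM.HermSpace3 F ι₁) (a₀ : RealScalar F)
      (Φ : CMType F) (hΦ : ι₁ ∈ Φ.1) (i : (I V (repAt a₀) (muLiu ι₁ GramClass.rep))),
      3 ≤ (datum413 hDel F V a₀ Φ i).n → ∀ t : (datum413 hDel F V a₀ Φ i).AdmTriple,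
        ∃ ψ₀ : (datum413 hDel F V a₀ Φ i).omegaAt t →ₗ[ℂ] ((adelicDatum F V).Adelic → (Fin 2 → ℂ)),
          ∀ ψ : (datum413 hDel F V a₀ Φ i).omegaAt t →ₗ[ℂ] ((adelicDatum F V).Adelic → (Fin 2 → ℂ)),
            (∀ (g : ↥(HodgeCM.HermSpace3.adelicFin V)) (w : (datum413 hDel F V a₀ Φ i).omegaAt t),
                ψ ((datum413 hDel F V a₀ Φ i).rhoAt t g w) = rightRep F V g (ψ w)) →
              (∀ w, ψ w ∈ (holCotForms (archFactorOf F V)).map (conjFun F V)) → ∃ r : ℂ, ψ = r • ψ₀ := by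
  intro hDel F _ h6 ι₁ V a₀ Φ hΦ i hn t
  -- the degenerate case: no non-zero equivariant `A`-valued map
  by_cases hex : ∃ ψ₁ : (datum413 hDel F V a₀ Φ i).omegaAt t →ₗ[ℂ] ((adelicDatum F V).Adelic → (Fin 2 → ℂ)),
      (∀ (g : ↥(HodgeCM.HermSpace3.adelicFin V)) (w : (datum413 hDel F V a₀ Φ i).omegaAt t),
          ψ₁ ((datum413 hDel F V a₀ Φ i).rhoAt t g w) = rightRep F V g (ψ₁ w)) ∧
        (∀ w, ψ₁ w ∈ (holCotForms (archFactorOf F V)).map (conjFun F V)) ∧ ψ₁ ≠ 0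
  swap
  · refine ⟨0, fun ψ hψe hψv => ⟨0, ?_⟩⟩
    have hψ0 : ψ = 0 := by
      by_contra hne
      exact hex ⟨ψ, hψe, hψv, hne⟩
    rw [hψ0, smul_zero]
  obtain ⟨ψ₁, hψ₁e, hψ₁v, hψ₁0⟩ := hex
  have h4 : 4 ≤ Module.finrank ℚ F := le_trans (by norm_num) h6
  have h2 : 2 ≤ Module.finrank ℚ ↥(maximalRealSubfield (HodgeCM.CMField.K F)) := by
    have h := Module.finrank_mul_finrank ℚ ↥(maximalRealSubfield (HodgeCM.CMField.K F)) (HodgeCM.CMField.K F)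
    rw [Algebra.IsQuadraticExtension.finrank_eq_two ↥(maximalRealSubfield (HodgeCM.CMField.K F)) (HodgeCM.CMField.K F)] at h
    change _ = Module.finrank ℚ F at h
    omega
  have h3 := Summit.HodgeConjecture.HodgeConjecture.R90.three_le_finrank_maximalRealSubfield_of_six_le (HodgeCM.CMField.K F) h6
  -- an automorphic measure with discretely decomposable `L²` (the quotient is compact: `Hm V` is anisotropic)
  obtain ⟨τ, hτ⟩ := UnitaryGroup.exists_infinitePlace_ne (HodgeCM.CMField.K F) h4 ι₁
  have han := UnitaryGroup.anisotropic_of_posDef_map (HodgeCM.CMField.K F) (HodgeCM.HermSpace3.Hm V) τ (V.posDef_of_ne τ hτ)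
  obtain ⟨μ, hμ, hdisc⟩ := UnitaryGroup.exists_isAutomorphicMeasure_isDiscretelyDecomposable_adelicGroupData (HodgeCM.CMField.K F) 3
    (HodgeCM.HermSpace3.Hm V) han
  haveI := hμ
  haveI := compactSpace_automorphicQuotient_adelicDatum F V h4
  -- `ω_V(t) ≠ 0` is irreducible, smooth, admissible ([Liu2021, Def. 4.11] = ★ `Theorems.H411_proof`)
  obtain ⟨w₁, hw₁⟩ : ∃ w, ψ₁ w ≠ 0 := by
    by_contra h
    push Not at h
    exact hψ₁0 (LinearMap.ext h)
  have hW : Nontrivial ((datum413 hDel F V a₀ Φ i).omegaAt t) := ⟨⟨w₁, 0, fun h => hw₁ (by rw [h, map_zero])⟩⟩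
  have hirr := isIrreducible_rhoAt_datum413 hDel F h6 V a₀ Φ hΦ i t hW
  have hadm := isAdmissible_rhoAt_datum413 hDel F h6 V a₀ Φ hΦ i t
  have hsm : ((datum413 hDel F V a₀ Φ i).rhoAt t).IsSmooth := hadm.isSmooth
  -- bookkeeping for equivariant `A`-valued maps: membership in `cohForms`, left invariance, continuity, `L²` classes
  have hcoh : ∀ {f : (adelicDatum F V).Adelic → (Fin 2 → ℂ)}, f ∈ (holCotForms (archFactorOf F V)).map (conjFun F V) → f ∈ cohForms (archFactorOf F V) := by
    intro f hf
    exact Submodule.mem_sup_right hf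
  have hleft : ∀ {f : (adelicDatum F V).Adelic → (Fin 2 → ℂ)}, f ∈ (holCotForms (archFactorOf F V)).map (conjFun F V) →
      ∀ γ ∈ (adelicDatum F V).quotientSubgroup, ∀ x, f (γ * x) = f x := by
    intro f hf
    exact leftInvariant_of_mem_cohForms_pin (hcoh hf)
  have hmem : ∀ {f : (adelicDatum F V).Adelic → (Fin 2 → ℂ)}, f ∈ (holCotForms (archFactorOf F V)).map (conjFun F V) →
      ∀ j : Fin 2, MemLp (toQuotFun (adelicDatum F V) fun x => f x j) 2 μ := by
    intro f hf j
    exact memLp_toQuotFun_pin h4 (hcoh hf) j (hcont F V h4 f (hcoh hf) j) 2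
  have heqv_generic : ∀ ψ : (datum413 hDel F V a₀ Φ i).omegaAt t →ₗ[ℂ] ((adelicDatum F V).Adelic → (Fin 2 → ℂ)),
      (∀ (g : ↥(HodgeCM.HermSpace3.adelicFin V)) (w : (datum413 hDel F V a₀ Φ i).omegaAt t),
          ψ ((datum413 hDel F V a₀ Φ i).rhoAt t g w) = rightRep F V g (ψ w)) →
        ∀ (g : ↥(HodgeCM.HermSpace3.adelicFin V)) (w : (datum413 hDel F V a₀ Φ i).omegaAt t),
          ψ ((datum413 hDel F V a₀ Φ i).rhoAt t g w) =
            CotangentForms.rightRep (↥(maximalRealSubfield (HodgeCM.CMField.K F))) (HodgeCM.CMField.K F)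
              (IsCMField.complexConj (HodgeCM.CMField.K F)) 3 (HodgeCM.HermSpace3.Hm V) g (ψ w) := by
    intro ψ hψe g w
    rw [← rightRep_eq_generic]
    exact hψe g w
  -- §1: a discrete `Π` not orthogonal to a coordinate class of `ψ w` has finite component `ω_V(t)`
  have hfin : ∀ (ψ : (datum413 hDel F V a₀ Φ i).omegaAt t →ₗ[ℂ] ((adelicDatum F V).Adelic → (Fin 2 → ℂ)))
      (hψe : ∀ (g : ↥(HodgeCM.HermSpace3.adelicFin V)) (w : (datum413 hDel F V a₀ Φ i).omegaAt t),
        ψ ((datum413 hDel F V a₀ Φ i).rhoAt t g w) = rightRep F V g (ψ w))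
      (hψv : ∀ w, ψ w ∈ (holCotForms (archFactorOf F V)).map (conjFun F V)) (P : DiscreteAutomorphicRep (adelicDatum F V) μ)
      (w : (datum413 hDel F V a₀ Φ i).omegaAt t) (j : Fin 2),
      (∃ u ∈ P.space, ⟪(u : (adelicDatum F V).L2 μ), (hmem (hψv w) j).toLp⟫_ℂ ≠ 0) →
        P.HasFinComponent ((datum413 hDel F V a₀ Φ i).rhoAt t) :=
    fun ψ hψe hψv P w j hu => F0P3SpectralJunction.hasFinComponent_of_not_orthogonal P ((datum413 hDel F V a₀ Φ i).rhoAt t) hirr ψ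
      (heqv_generic ψ hψe) (fun w => hleft (hψv w)) (fun w j => hcont F V h4 (ψ w) (hcoh (hψv w)) j) (hmem (hψv w) j) hu
  -- letter (D): such a `Π` is `IsAntiholCotangentAt`-cohomological
  have htype : ∀ (ψ : (datum413 hDel F V a₀ Φ i).omegaAt t →ₗ[ℂ] ((adelicDatum F V).Adelic → (Fin 2 → ℂ)))
      (hψv : ∀ w, ψ w ∈ (holCotForms (archFactorOf F V)).map (conjFun F V)) (P : DiscreteAutomorphicRep (adelicDatum F V) μ)
      (w : (datum413 hDel F V a₀ Φ i).omegaAt t) (j : Fin 2),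
      (∃ u ∈ P.space, ⟪(u : (adelicDatum F V).L2 μ), (hmem (hψv w) j).toLp⟫_ℂ ≠ 0) →
        P.IsAntiholCotangentAt (archFactorOf F V).ιinf (archFactorOf F V).Kc :=
    fun ψ hψv P w j hu => hDantihol (HodgeCM.CMField.K F) ι₁ (HodgeCM.HermSpace3.Hm V) V.sylvesterFrame (HodgeCM.Model.sylvesterFrame_J V)
      V.posDef_of_ne h2 μ P (ψ w) (hψv w) (hmem (hψv w)) ⟨j, hu⟩
  -- THE `Π₀`: an irreducible closed subspace not orthogonal to a non-zero coordinate class of `ψ₁ w₁`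
  obtain ⟨x₁, j₁, hx₁⟩ : ∃ (x : (adelicDatum F V).Adelic) (j : Fin 2), ψ₁ w₁ x j ≠ 0 := by
    by_contra h
    push Not at h
    exact hw₁ (funext fun x => funext fun j => h x j)
  have hΦne : (fun y => ψ₁ w₁ y j₁) ≠ 0 := fun h0 => hx₁ (by simpa using congrFun h0 x₁)
  have hv₁ : (hmem (hψ₁v w₁) j₁).toLp (toQuotFun (adelicDatum F V) fun x => ψ₁ w₁ x j₁) ≠ 0 :=
    toLp_toQuotFun_ne_zero (fun γ hγ x => by simp only [hleft (hψ₁v w₁) γ hγ x])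
      (hcont F V h4 (ψ₁ w₁) (hcoh (hψ₁v w₁)) j₁) (hmem (hψ₁v w₁) j₁) hΦne
  obtain ⟨W₀, hW₀irr, u₁, hu₁, hu₁v⟩ := exists_irreducible_not_orthogonal hdisc hv₁
  let P₀ : DiscreteAutomorphicRep (adelicDatum F V) μ := ⟨W₀, hW₀irr⟩
  have hP₀type : P₀.IsAntiholCotangentAt (archFactorOf F V).ιinf (archFactorOf F V).Kc := htype ψ₁ hψ₁v P₀ w₁ j₁ ⟨u₁, hu₁, hu₁v⟩
  have hP₀fin : P₀.HasFinComponent ((datum413 hDel F V a₀ Φ i).rhoAt t) := hfin ψ₁ hψ₁e hψ₁v P₀ w₁ j₁ ⟨u₁, hu₁, hu₁v⟩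
  -- letter (E) at `Π₀`
  obtain ⟨ψ₀, hψ₀⟩ := hEantihol (HodgeCM.CMField.K F) ι₁ (HodgeCM.HermSpace3.Hm V) V.sylvesterFrame (HodgeCM.Model.sylvesterFrame_J V)
    V.posDef_of_ne h2 μ ((datum413 hDel F V a₀ Φ i).omegaAt t) ((datum413 hDel F V a₀ Φ i).rhoAt t) hirr hsm hadm P₀
  refine ⟨ψ₀, fun ψ hψe hψv => hψ₀ ψ (heqv_generic ψ hψe) fun w => ⟨hψv w, ?_⟩⟩
  -- every coordinate class of `ψ w` lies in `Π₀`: all other discrete `Π` it could meet are `IsAntiholCotangentAt`-type with finite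
  -- component `ω_V(t)`, hence `= Π₀` by E1′; distinct `Π` are orthogonal by E1
  rw [containsForm_iff_of_memLp P₀ (ψ w) (hmem (hψv w))]
  intro j
  -- E1_coh: multiplicity `≤ 1` at the `(0,1)`-cohomological `Π₀` only (★ `F0P3MultiplicityLocal`)
  refine mem_space_of_forall_detected_eq_of_multiplicity_le_one hdisc P₀
    (hE1c (HodgeCM.CMField.K F) ι₁ (HodgeCM.HermSpace3.Hm V) V.sylvesterFrame (HodgeCM.Model.sylvesterFrame_J V) V.posDef_of_ne h2 h3 μ
      P₀ (Or.inr hP₀type)) _ fun P hu => ?_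
  exact hE1' (HodgeCM.CMField.K F) ι₁ (HodgeCM.HermSpace3.Hm V) V.sylvesterFrame (HodgeCM.Model.sylvesterFrame_J V) V.posDef_of_ne h2 h3 μ
    ((datum413 hDel F V a₀ Φ i).omegaAt t) ((datum413 hDel F V a₀ Φ i).rhoAt t) hirr hsm P P₀ (htype ψ hψv P w j hu) hP₀type
    (hfin ψ hψe hψv P w j hu) hP₀fin

/-! ## §2 The by-name form over the ★ letters (D)antihol, (E)antihol -/

set_option synthInstance.maxHeartbeats 400000 in
set_option maxHeartbeats 8000000 in
/-- **S4 FROM E1_coh₃, E1′a₃ AND THE TWO ★ LETTERS BY NAME** — ★ `stubS4_holds_coh` twin: (D) ★ `antiholCotFormSpectralProjection`, (E) ★ `cohIsotypicLine_antihol` by name.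
HC_CM is proved only modulo the printed citations until rung 0 closes. [cite: Rogawski1990, §14.6 Thm. 14.6.4; §15.3 ¶1] [cite: BorelJacquet1979, §4.6]
[cite: BorelWallach2000, VII 2.10, 3.2 and 3.6] [cite: Liu2021, proof of Prop. 4.13, l. 2131–2146] -/
theorem stubS4_holds_coh₃
    (hE1c : StubE1coh₃)
    (hE1' : CohFinComponentUniqueAntihol₃)
    (hD : Literature.NumberTheory.Automorphic.UnitaryGroup.CotangentForms.antiholCotFormSpectralProjection)
    (hE : Literature.NumberTheory.Automorphic.UnitaryGroup.CotangentForms.cohIsotypicLine_antihol) :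
    ∀ (hDel : Literature.AlgebraicGeometry.ShimuraVarieties.UnitaryCanonicalModel.canonicalModel_exists_printed)
      (F : HodgeCM.CMField) [IsGalois ℚ F] (h6 : 6 ≤ Module.finrank ℚ F) {ι₁ : F →+* ℂ} (V : HodgeCM.HermSpace3 F ι₁) (a₀ : RealScalar F)
      (Φ : CMType F) (hΦ : ι₁ ∈ Φ.1) (i : (I V (repAt a₀) (muLiu ι₁ GramClass.rep))),
      3 ≤ (datum413 hDel F V a₀ Φ i).n → ∀ t : (datum413 hDel F V a₀ Φ i).AdmTriple,
        ∃ ψ₀ : (datum413 hDel F V a₀ Φ i).omegaAt t →ₗ[ℂ] ((adelicDatum F V).Adelic → (Fin 2 → ℂ)),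
          ∀ ψ : (datum413 hDel F V a₀ Φ i).omegaAt t →ₗ[ℂ] ((adelicDatum F V).Adelic → (Fin 2 → ℂ)),
            (∀ (g : ↥(HodgeCM.HermSpace3.adelicFin V)) (w : (datum413 hDel F V a₀ Φ i).omegaAt t),
                ψ ((datum413 hDel F V a₀ Φ i).rhoAt t g w) = rightRep F V g (ψ w)) →
              (∀ w, ψ w ∈ (holCotForms (archFactorOf F V)).map (conjFun F V)) → ∃ r : ℂ, ψ = r • ψ₀ :=
  stubS4_of_letters_coh₃ hE1c hE1' (F0P3LetterAdapters.detection_antihol_of_spectralProjection hD)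
    (F0P3LetterAdapters.isotypicLine_antihol_of_filed hE) CohFormsL2.continuous_apply_of_mem_cohForms

end Summit.HodgeConjecture.HodgeConjecture.Cruxes.H413.F0P3StubS4FoldCoh3

end
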